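import Summits.QuantumFields.BalabanUV.Beta.GAN24.ExitFaceCurrentDescent
import Summits.QuantumFields.BalabanUV.Beta.GAN24.ExitFaceCurrentSectorSplit

/-!
# `BalabanUV.Beta.GAN24.CubicSectorCurrentExpansion` — binder row G-an2-4 ∕ (CONV-C), W-slot CT-W, conservation law (C)∕(C)sym AT ALL LEVELS, the expansion behind the (A)-tower of
# this lineage's note `HOME/b2b-balaban-gan24-formalise-leaf-04/g68/EXIT-FACE-CURRENT-TOWER.md` §2: **THE SLOT∕LEG-WEIGHTED TWO-LEG CURRENT OF THE CUBIC SECTOR `e3OfK Lc G_j S`, FREE LEG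
# SECOND, IS THE LEVEL-`j` RESPONSE-WEIGHTED CURRENT OF `S` READ THROUGH ONE PASSIVE `G_j`** — for `|σ|, |ρ| ≤ 1` and a leg datum `ρ ê_β` with zero multiplier response,
# `Σ'_w ρ w·Σ'_t σ t·e3OfK Lc G_j S ν t w y (inl β)(inl μ) = Σ'_p Σ_a t^{(j)}(p, a)·G_j p (Lc•y) a (inr μ)`,
# `t^{(j)}(p,a) := Σ_κ″ Σ'_q H_ρ(κ″,q)·Σ_κ‴ Σ'_u H_σ(κ‴,u)·S κ‴ u q p (inl κ″) a` (weighted leg `q` first, free leg `(p,a)` second — field AND multiplier).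

NOT IN PRINT; OUR BOOKKEEPING ([folklore] `tsum` bookkeeping BY NAME over this lineage's `ExitFaceCurrentDescent.tsum_leg_comp_eq_neg_fieldResponse ∕ tsum_midleg_slot_comm ∕ abs_legResponse_le`,
`ExitFaceCurrentDivBlockSum.tsum_leg_slot_comm ∕ summable_slot_biLocFamily`, `ExitFaceCurrentSectorSplit.abs_tsum_slot_locStencil_le`, `SlotWeightedVertex.tsum_slotWeight_vertexOfK`, an2's
`ValueJetGeneric.e3OfK_apply`, `BalabanStepJetsSucc.mmRead_inl_inl ∕ biLoc_comp_right`, pv's `KernelWard.comp_assoc_of_bound`; G-an2-4 formalisation swarm, leaf prover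
`b2b-balaban-gan24-formalise-leaf-04`, gen 69).  HONEST FRAMING (cell contract, verbatim): «discharging `BetaPertH` makes Bałaban's UV stability UNCONDITIONAL — a real constructive-QFT
result; it is NOT the continuum limit and NOT the Clay problem.»  HONEST DEPENDENCY (verbatim): «continuum YM on T⁴ ⇐ BetaPertH ∧ nine spine estimates (0/9 proved); BetaPertH ⇐ (D1) ∧ (D4) ∧
CAP+tail; G-an2-4 gates asym, D1 and NE2/3/4.»

WHY.  The (D)-tower (`ExitFaceCurrentDescent`) differentiated the free leg and used an2's Ward identity for the left `G_j`; the (A)-tower («`S(a;·;b) + S(b;·;a) = 0`», input of (L3c)_j)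
keeps BOTH resolvents passive: `e3OfK = −mmRead(G ∘ 𝒱 ∘ G) = −mmRead(G ∘ (𝒱 ∘ G))` (associativity, decaying ∘ bi-localised ∘ decaying), the `ρ`-leg contracts the LEFT `G` into the field
response `H_ρ` (zero multiplier response), the slot weight `σ` opens the chain-rule vertex into `H_σ`, and the RIGHT `G` stays as the passive factor `G_j p (Lc•y) a (inr μ)` summed over
ALL intermediate legs `(p, a)` — so the symmetrised current one level up vanishes as soon as the level-`j` symmetrised current vanishes at every free leg, multiplier legs included
(`CubicSectorCurrentSym`).

WHAT ([folklore]; generic `d`, `[NeZero Lc]`, in-block root, every `j`, ANY local table family `S`; 0 `def`, 0 cited facts, 0 `def … : Prop`, 0 sorry): §1 `comp_assoc_dbd`,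
`e3OfK_inl_inl_eq_neg_comp`; §2 `summable_slot_rightleg`, `tsum_slot_comp_right` (the `(t,p)` exchange through the passive right factor); §3 `summable_midleg_freeleg`,
`tsum_midleg_freeleg_comm` (the `(q,p)` exchange: bounded mid-leg weight × two-leg current decaying in `|p − q|` × decaying passive factor); §4 **`faceSlot_current_eq_tsum_freeLeg`**
(the headline).  Asserts NO value of Bałaban's tables; discharges NOTHING of (C)sym ∕ (Q-D) ∕ (Q-D-rate) ∕ «T2Shape» ∕ «T2Drift» ∕ (hW, hWall); NEVER «G-an2-4 closed» as (CONV-C);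
NOT D1, NOT `BetaPertH`, NOT continuum, NOT Clay.  2026-08-23; no existing file touched.
-/

noncomputable section

open Finset
open scoped BigOperators
open Literature.MathematicalPhysics.QuantumFieldTheory
open Literature.MathematicalPhysics.QuantumFieldTheory.Balaban1983to89
open Literature.MathematicalPhysics.QuantumFieldTheory.Balaban1983to89.Beta
open B12Sec2to5 (l1 l1_nonneg)
open ExpKernelCalculus (Site MKer comp Decays BiLoc Zl Zl_nonneg exp_split summable_exp_shift summable_exp_shift' tsum_exp_shift tsum_exp_shift' l1_sub_symm biLoc_comp_decays)
open AffineAveraging (box toSite)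
open OneStepResolventKernel (Fib LocStencil biLoc_mono decays_mono)
open OneStepKernelFamily (KInvStep vertexOfK colH vertexFamily_vertexOfK)
open KernelWard (comp_assoc_of_bound bdd_of_decays bdd_of_biLoc)
open BalabanStepJetsSucc (mmRead mmRead_inl_inl biLoc_comp_right)
open Summit.QuantumFields.BalabanUV.Beta.TameKernelCalculus (trK)
open Summit.QuantumFields.BalabanUV.Beta.BorderedHessian (sgnK)
open Summit.QuantumFields.BalabanUV.Beta.AxialDressingRooted (coDressKBmAt decays_coDressKBmAt_KInvStep)
open Summit.QuantumFields.BalabanUV.Beta.BubbleParity (trK_coDressKBmAt_KInvStep)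
open Summit.QuantumFields.BalabanUV.Beta.SpineRooted (e3OfK e3OfK_apply)
open Summit.QuantumFields.BalabanUV.Beta.GAN24.ResolventLegCharges (summable_exp_coarse')
open Summit.QuantumFields.BalabanUV.Beta.GAN24.ExitFaceCurrentDivBlockSum (summable_slot_biLocFamily tsum_leg_slot_comm)
open Summit.QuantumFields.BalabanUV.Beta.GAN24.ExitFaceCurrentDescent (abs_legResponse_le tsum_midleg_slot_comm tsum_leg_comp_eq_neg_fieldResponse)
open Summit.QuantumFields.BalabanUV.Beta.GAN24.ExitFaceCurrentSectorSplit (abs_tsum_slot_locStencil_le summable_slot_locStencil)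
open Summit.QuantumFields.BalabanUV.Beta.GAN24.SlotWeightedVertex (tsum_slotWeight_vertexOfK)

namespace Summit.QuantumFields.BalabanUV.Beta.GAN24.CubicSectorCurrentExpansion

variable {d : ℕ} {Lc : ℕ} [NeZero Lc] {r : Fin (d + 1) → ℕ} {S : Fin (d + 1) → (Fin (d + 1) → ℤ) → MKer (d + 1) (Fib d)} {Cs δs : ℝ}

/-! ## §1 Associativity and the pointwise expansion -/

omit [NeZero Lc] in
/-- [folklore] Associativity of kernel composition, decaying ∘ bi-localised ∘ decaying (pv's `comp_assoc_of_bound` with the obvious majorant). -/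
theorem comp_assoc_dbd {D : ℕ} {F : Type} [Fintype F] {A K L : MKer D F} {C Ck Cl δ : ℝ} {p q : Fin D → ℤ} (hA : Decays A C δ)
    (hK : BiLoc K p q Ck δ) (hL : Decays L Cl δ) (hδ : 0 < δ) : comp A (comp K L) = comp (comp A K) L := by
  refine comp_assoc_of_bound fun x w a b => ?_
  have hC : 0 ≤ C := hA.nonneg a
  have hCk : 0 ≤ Ck := hK.nonneg a
  have hCl : 0 ≤ Cl := hL.nonneg a
  refine ⟨fun y => C * Ck * Cl * Real.exp (-δ * l1 (y - p)), fun z => Real.exp (-δ * l1 (z - q)),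
    (summable_exp_shift' hδ p).mul_left _, summable_exp_shift' hδ q, fun y => by positivity, fun z => by positivity, fun y z f g => ?_⟩
  have h1 : |A x y a f| ≤ C := bdd_of_decays hA hδ.le x y a f
  have h2 : |K y z f g| ≤ Ck * Real.exp (-δ * l1 (y - p)) * Real.exp (-δ * l1 (z - q)) := by
    have := hK y z f g
    rwa [show -δ * (l1 (y - p) + l1 (z - q)) = -δ * l1 (y - p) + -δ * l1 (z - q) by ring, Real.exp_add, ← mul_assoc] at this
  have h3 : |L z w g b| ≤ Cl := bdd_of_decays hL hδ.le z w g b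
  rw [abs_mul, abs_mul]
  calc |A x y a f| * |K y z f g| * |L z w g b| ≤ C * (Ck * Real.exp (-δ * l1 (y - p)) * Real.exp (-δ * l1 (z - q))) * Cl :=
        mul_le_mul (mul_le_mul h1 h2 (abs_nonneg _) hC) h3 (abs_nonneg _) (mul_nonneg hC (by positivity))
    _ = C * Ck * Cl * Real.exp (-δ * l1 (y - p)) * Real.exp (-δ * l1 (z - q)) := by ring

omit [NeZero Lc] in
/-- [folklore] **THE CUBIC SECTOR ON FIELD LEGS IS MINUS THE `mm` BLOCK OF `G ∘ (𝒱 ∘ G)`**: `e3OfK N G S ν t w y (inl β)(inl μ) = −(G ∘ (vertexOfK G N S ν t ∘ G))(N•w, N•y)(inr β, inr μ)`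
(definition + associativity for decaying `G`, bi-localised vertex). -/
theorem e3OfK_inl_inl_eq_neg_comp {N : ℕ} {G : MKer (d + 1) (Fib d)} {C δ : ℝ} (hG : Decays G C δ) (hδ : 0 < δ)
    {Cv : ℝ} {t : Site (d + 1)} (ν : Fin (d + 1)) (hV : BiLoc (vertexOfK G N S ν t) ((N : ℤ) • t) ((N : ℤ) • t) Cv δ)
    (w y : Site (d + 1)) (β μ : Fin (d + 1)) :
    e3OfK N G S ν t w y (Sum.inl β) (Sum.inl μ) = -(comp G (comp (vertexOfK G N S ν t) G) ((N : ℤ) • w) ((N : ℤ) • y) (Sum.inr β) (Sum.inr μ)) := by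
  rw [e3OfK_apply, mmRead_inl_inl, comp_assoc_dbd hG hV hG hδ]

/-! ## §2 The `(t,p)` exchange through the passive right factor -/

/-- [folklore] For a family `V_t` bi-localised at `(Lc•t, Lc•t)`, a bounded right factor `g` and a slot weight `|σ| ≤ 1`, the `(t,p)` family `σ t·V_t q p c a·g p a` is absolutely summable
(`q, c` fixed). -/
theorem summable_slot_rightleg {V : Site (d + 1) → MKer (d + 1) (Fib d)} {C δ : ℝ} (hV : ∀ t, BiLoc (V t) ((Lc : ℤ) • t) ((Lc : ℤ) • t) C δ) (hδ : 0 < δ)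
    {σ : Site (d + 1) → ℝ} (hσ : ∀ t, |σ t| ≤ 1) {g : Site (d + 1) → Fib d → ℝ} {B : ℝ} (hg : ∀ p a, |g p a| ≤ B) (q : Site (d + 1)) (c a : Fib d) :
    Summable fun tp : Site (d + 1) × Site (d + 1) => |σ tp.1 * (V tp.1 q tp.2 c a * g tp.2 a)| := by
  have hLc : 1 ≤ Lc := Nat.one_le_iff_ne_zero.mpr (NeZero.ne Lc)
  have hC : 0 ≤ C := (hV 0).nonneg (Sum.inl 0)
  have hB : 0 ≤ B := (abs_nonneg _).trans (hg 0 (Sum.inl 0))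
  have hMs : Summable fun tp : Site (d + 1) × Site (d + 1) => C * B * (Real.exp (-δ * l1 (q - (Lc : ℤ) • tp.1)) * Real.exp (-δ * l1 (tp.2 - (Lc : ℤ) • tp.1))) := by
    refine Summable.mul_left (C * B) ?_
    refine (summable_prod_of_nonneg (fun tp => mul_nonneg (Real.exp_pos _).le (Real.exp_pos _).le)).2 ⟨fun t => ?_, ?_⟩
    · exact (summable_exp_shift' hδ ((Lc : ℤ) • t)).mul_left (Real.exp (-δ * l1 (q - (Lc : ℤ) • t)))
    · have hb : ∀ t : Site (d + 1), ∑' p : Site (d + 1), Real.exp (-δ * l1 (q - (Lc : ℤ) • t)) * Real.exp (-δ * l1 (p - (Lc : ℤ) • t)) =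
          Real.exp (-δ * l1 (q - (Lc : ℤ) • t)) * Zl (d + 1) δ := by
        intro t
        rw [tsum_mul_left, tsum_exp_shift' ((Lc : ℤ) • t)]
      simp only [hb]
      exact (summable_exp_coarse' (d := d) hLc hδ q).mul_right (Zl (d + 1) δ)
  refine Summable.of_nonneg_of_le (fun _ => abs_nonneg _) (fun tp => ?_) hMs
  rw [abs_mul, abs_mul]
  have h := hV tp.1 q tp.2 c a
  calc |σ tp.1| * (|V tp.1 q tp.2 c a| * |g tp.2 a|) ≤ 1 * ((C * Real.exp (-δ * (l1 (q - (Lc : ℤ) • tp.1) + l1 (tp.2 - (Lc : ℤ) • tp.1)))) * B) :=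
        mul_le_mul (hσ tp.1) (mul_le_mul h (hg tp.2 a) (abs_nonneg _) (by positivity)) (by positivity) zero_le_one
    _ = C * B * (Real.exp (-δ * l1 (q - (Lc : ℤ) • tp.1)) * Real.exp (-δ * l1 (tp.2 - (Lc : ℤ) • tp.1))) := by
        rw [one_mul, mul_add, Real.exp_add]; ring

/-- [folklore] **THE `(t,p)` EXCHANGE THROUGH A PASSIVE RIGHT FACTOR**: for a family `V_t` bi-localised at `(Lc•t, Lc•t)`, a decaying `G` and `|σ| ≤ 1`,
`Σ'_t σ t·(V_t ∘ G)(q, z)(c, b) = Σ'_p Σ_a (Σ'_t σ t·V_t q p c a)·G p z a b`, and the `p`-family on the right is summable. -/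
theorem tsum_slot_comp_right {V : Site (d + 1) → MKer (d + 1) (Fib d)} {C δ : ℝ} (hV : ∀ t, BiLoc (V t) ((Lc : ℤ) • t) ((Lc : ℤ) • t) C δ) (hδ : 0 < δ)
    {G : MKer (d + 1) (Fib d)} {CG δG : ℝ} (hG : Decays G CG δG) (hδG : 0 ≤ δG)
    {σ : Site (d + 1) → ℝ} (hσ : ∀ t, |σ t| ≤ 1) (q z : Site (d + 1)) (c b : Fib d) :
    (Summable fun p : Site (d + 1) => ∑ a : Fib d, (∑' t : Site (d + 1), σ t * V t q p c a) * G p z a b) ∧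
    ∑' t : Site (d + 1), σ t * comp (V t) G q z c b = ∑' p : Site (d + 1), ∑ a : Fib d, (∑' t : Site (d + 1), σ t * V t q p c a) * G p z a b := by
  classical
  have hC : 0 ≤ C := (hV 0).nonneg (Sum.inl 0)
  have hgb : ∀ p a, |G p z a b| ≤ CG := fun p a => bdd_of_decays hG hδG p z a b
  -- per intermediate leg `a`: the `(t,p)` family and its two iterated sums
  have hs : ∀ a : Fib d, Summable fun tp : Site (d + 1) × Site (d + 1) => σ tp.1 * (V tp.1 q tp.2 c a * G tp.2 z a b) := fun a =>
    Summable.of_norm_bounded (summable_slot_rightleg hV hδ hσ hgb q c a) (fun tp => by rw [Real.norm_eq_abs])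
  have hs' : ∀ a : Fib d, Summable fun pt : Site (d + 1) × Site (d + 1) => σ pt.2 * (V pt.2 q pt.1 c a * G pt.1 z a b) := fun a =>
    ((Equiv.prodComm (Site (d + 1)) (Site (d + 1))).summable_iff.2 (hs a)).congr fun pt => by simp
  have hswap : ∀ a : Fib d, ∑' t : Site (d + 1), ∑' p : Site (d + 1), σ t * (V t q p c a * G p z a b) =
      ∑' p : Site (d + 1), ∑' t : Site (d + 1), σ t * (V t q p c a * G p z a b) := by
    intro a
    calc ∑' t : Site (d + 1), ∑' p : Site (d + 1), σ t * (V t q p c a * G p z a b)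
        = ∑' tp : Site (d + 1) × Site (d + 1), σ tp.1 * (V tp.1 q tp.2 c a * G tp.2 z a b) := ((hs a).tsum_prod).symm
      _ = ∑' pt : Site (d + 1) × Site (d + 1), σ pt.2 * (V pt.2 q pt.1 c a * G pt.1 z a b) := by
          rw [← (Equiv.prodComm (Site (d + 1)) (Site (d + 1))).tsum_eq (fun tp : Site (d + 1) × Site (d + 1) => σ tp.1 * (V tp.1 q tp.2 c a * G tp.2 z a b))]
          exact tsum_congr fun pt => by simp [Equiv.prodComm_apply]
      _ = _ := (hs' a).tsum_prod
  -- the inner `t`-sum factors the passive `G`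
  have hinner : ∀ (a : Fib d) (p : Site (d + 1)), ∑' t : Site (d + 1), σ t * (V t q p c a * G p z a b) = (∑' t : Site (d + 1), σ t * V t q p c a) * G p z a b := by
    intro a p
    rw [← tsum_mul_right]
    exact tsum_congr fun t => by ring
  have hsumP : ∀ a : Fib d, Summable fun p : Site (d + 1) => (∑' t : Site (d + 1), σ t * V t q p c a) * G p z a b := fun a =>
    ((hs' a).prod).congr fun p => hinner a p
  refine ⟨summable_sum fun a _ => hsumP a, ?_⟩
  -- unfold the composition, split the middle leg, exchange
  have hpt : ∀ t : Site (d + 1), σ t * comp (V t) G q z c b = ∑ a : Fib d, ∑' p : Site (d + 1), σ t * (V t q p c a * G p z a b) := by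
    intro t
    rw [comp]
    have hsa : ∀ a : Fib d, Summable fun p : Site (d + 1) => V t q p c a * G p z a b := by
      intro a
      refine Summable.of_norm_bounded ((summable_exp_shift' hδ ((Lc : ℤ) • t)).mul_left (C * Real.exp (-δ * l1 (q - (Lc : ℤ) • t)) * CG)) (fun p => ?_)
      rw [Real.norm_eq_abs, abs_mul]
      have h := hV t q p c a
      calc |V t q p c a| * |G p z a b| ≤ C * Real.exp (-δ * (l1 (q - (Lc : ℤ) • t) + l1 (p - (Lc : ℤ) • t))) * CG := mul_le_mul h (hgb p a) (abs_nonneg _) (by positivity)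
        _ = C * Real.exp (-δ * l1 (q - (Lc : ℤ) • t)) * CG * Real.exp (-δ * l1 (p - (Lc : ℤ) • t)) := by rw [mul_add, Real.exp_add]; ring
    rw [Summable.tsum_finsetSum (fun a _ => hsa a), Finset.mul_sum]
    refine Finset.sum_congr rfl fun a _ => ?_
    rw [← tsum_mul_left]
  rw [tsum_congr hpt, Summable.tsum_finsetSum (fun a _ => ((hs a).prod).congr fun t => rfl), Summable.tsum_finsetSum (fun a _ => hsumP a)]
  refine Finset.sum_congr rfl fun a _ => ?_
  rw [hswap a]
  exact tsum_congr fun p => hinner a p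

/-! ## §3 The `(q,p)` exchange -/

omit [NeZero Lc] in
/-- [folklore] For a bounded mid-leg weight `H`, a two-leg kernel `T q p a` decaying in `|p − q|` and a right factor `g p a` decaying from a fixed point, the `(q,p)` family `H q·T q p a·g p a` is
absolutely summable. -/
theorem summable_midleg_freeleg {H : Site (d + 1) → ℝ} {B : ℝ} (hH : ∀ q, |H q| ≤ B) {T : Site (d + 1) → Site (d + 1) → Fib d → ℝ} {CT δT : ℝ} (hδT : 0 < δT)
    (hT : ∀ q p a, |T q p a| ≤ CT * Real.exp (-δT * l1 (p - q))) {g : Site (d + 1) → Fib d → ℝ} {Cg δg : ℝ} {z : Site (d + 1)} (hδg : 0 < δg)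
    (hg : ∀ p a, |g p a| ≤ Cg * Real.exp (-δg * l1 (p - z))) (a : Fib d) :
    Summable fun qp : Site (d + 1) × Site (d + 1) => |H qp.1 * (T qp.1 qp.2 a * g qp.2 a)| := by
  have hB : 0 ≤ B := (abs_nonneg _).trans (hH 0)
  have hCT : 0 ≤ CT := by
    have h := (abs_nonneg _).trans (hT 0 0 a)
    exact nonneg_of_mul_nonneg_left h (Real.exp_pos _)
  have hCg : 0 ≤ Cg := by
    have h := (abs_nonneg _).trans (hg 0 a)
    exact nonneg_of_mul_nonneg_left h (Real.exp_pos _)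
  have hMs : Summable fun qp : Site (d + 1) × Site (d + 1) => B * CT * Cg * (Real.exp (-δT * l1 (qp.2 - qp.1)) * Real.exp (-δg * l1 (qp.2 - z))) := by
    refine Summable.mul_left (B * CT * Cg) ?_
    have hs : Summable fun pq : Site (d + 1) × Site (d + 1) => Real.exp (-δT * l1 (pq.1 - pq.2)) * Real.exp (-δg * l1 (pq.1 - z)) := by
      refine (summable_prod_of_nonneg (fun pq => mul_nonneg (Real.exp_pos _).le (Real.exp_pos _).le)).2 ⟨fun p => ?_, ?_⟩
      · exact (summable_exp_shift hδT p).mul_right (Real.exp (-δg * l1 (p - z)))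
      · have hb : ∀ p : Site (d + 1), ∑' q : Site (d + 1), Real.exp (-δT * l1 (p - q)) * Real.exp (-δg * l1 (p - z)) = Zl (d + 1) δT * Real.exp (-δg * l1 (p - z)) := by
          intro p
          rw [tsum_mul_right, tsum_exp_shift p]
        simp only [hb]
        exact (summable_exp_shift' hδg z).mul_left (Zl (d + 1) δT)
    exact ((Equiv.prodComm (Site (d + 1)) (Site (d + 1))).summable_iff.2 hs).congr fun qp => by simp
  refine Summable.of_nonneg_of_le (fun _ => abs_nonneg _) (fun qp => ?_) hMs
  rw [abs_mul, abs_mul]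
  calc |H qp.1| * (|T qp.1 qp.2 a| * |g qp.2 a|) ≤ B * ((CT * Real.exp (-δT * l1 (qp.2 - qp.1))) * (Cg * Real.exp (-δg * l1 (qp.2 - z)))) :=
        mul_le_mul (hH qp.1) (mul_le_mul (hT qp.1 qp.2 a) (hg qp.2 a) (abs_nonneg _) (by positivity)) (by positivity) hB
    _ = B * CT * Cg * (Real.exp (-δT * l1 (qp.2 - qp.1)) * Real.exp (-δg * l1 (qp.2 - z))) := by ring

omit [NeZero Lc] in
/-- [folklore] **THE `(q,p)` EXCHANGE**: `Σ'_q H q·Σ'_p Σ_a T q p a·g p a = Σ'_p Σ_a (Σ'_q H q·T q p a)·g p a` (hypotheses of `summable_midleg_freeleg`), with the summabilities of the two outer families. -/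
theorem tsum_midleg_freeleg_comm {H : Site (d + 1) → ℝ} {B : ℝ} (hH : ∀ q, |H q| ≤ B) {T : Site (d + 1) → Site (d + 1) → Fib d → ℝ} {CT δT : ℝ} (hδT : 0 < δT)
    (hT : ∀ q p a, |T q p a| ≤ CT * Real.exp (-δT * l1 (p - q))) {g : Site (d + 1) → Fib d → ℝ} {Cg δg : ℝ} {z : Site (d + 1)} (hδg : 0 < δg)
    (hg : ∀ p a, |g p a| ≤ Cg * Real.exp (-δg * l1 (p - z))) :
    (Summable fun q : Site (d + 1) => H q * ∑' p : Site (d + 1), ∑ a : Fib d, T q p a * g p a) ∧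
    (Summable fun p : Site (d + 1) => ∑ a : Fib d, (∑' q : Site (d + 1), H q * T q p a) * g p a) ∧
    ∑' q : Site (d + 1), H q * ∑' p : Site (d + 1), ∑ a : Fib d, T q p a * g p a = ∑' p : Site (d + 1), ∑ a : Fib d, (∑' q : Site (d + 1), H q * T q p a) * g p a := by
  classical
  have hs : ∀ a : Fib d, Summable fun qp : Site (d + 1) × Site (d + 1) => H qp.1 * (T qp.1 qp.2 a * g qp.2 a) := fun a =>
    Summable.of_norm_bounded (summable_midleg_freeleg hH hδT hT hδg hg a) (fun qp => by rw [Real.norm_eq_abs])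
  have hs' : ∀ a : Fib d, Summable fun pq : Site (d + 1) × Site (d + 1) => H pq.2 * (T pq.2 pq.1 a * g pq.1 a) := fun a =>
    ((Equiv.prodComm (Site (d + 1)) (Site (d + 1))).summable_iff.2 (hs a)).congr fun pq => by simp
  have hswap : ∀ a : Fib d, ∑' q : Site (d + 1), ∑' p : Site (d + 1), H q * (T q p a * g p a) = ∑' p : Site (d + 1), ∑' q : Site (d + 1), H q * (T q p a * g p a) := by
    intro a
    calc ∑' q : Site (d + 1), ∑' p : Site (d + 1), H q * (T q p a * g p a)
        = ∑' qp : Site (d + 1) × Site (d + 1), H qp.1 * (T qp.1 qp.2 a * g qp.2 a) := ((hs a).tsum_prod).symm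
      _ = ∑' pq : Site (d + 1) × Site (d + 1), H pq.2 * (T pq.2 pq.1 a * g pq.1 a) := by
          rw [← (Equiv.prodComm (Site (d + 1)) (Site (d + 1))).tsum_eq (fun qp : Site (d + 1) × Site (d + 1) => H qp.1 * (T qp.1 qp.2 a * g qp.2 a))]
          exact tsum_congr fun pq => by simp [Equiv.prodComm_apply]
      _ = _ := (hs' a).tsum_prod
  have hinnerP : ∀ (a : Fib d) (p : Site (d + 1)), ∑' q : Site (d + 1), H q * (T q p a * g p a) = (∑' q : Site (d + 1), H q * T q p a) * g p a := by
    intro a p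
    rw [← tsum_mul_right]
    exact tsum_congr fun q => by ring
  have hinnerQ : ∀ (a : Fib d) (q : Site (d + 1)), ∑' p : Site (d + 1), H q * (T q p a * g p a) = H q * ∑' p : Site (d + 1), T q p a * g p a := fun a q => tsum_mul_left
  have hsumP : ∀ a : Fib d, Summable fun p : Site (d + 1) => (∑' q : Site (d + 1), H q * T q p a) * g p a := fun a => ((hs' a).prod).congr fun p => hinnerP a p
  have hsumQ : ∀ a : Fib d, Summable fun q : Site (d + 1) => H q * ∑' p : Site (d + 1), T q p a * g p a := fun a => ((hs a).prod).congr fun q => hinnerQ a q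
  -- the `p`-family inside `Σ'_q H q·(…)`, per `a`
  have hsumPa : ∀ (q : Site (d + 1)) (a : Fib d), Summable fun p : Site (d + 1) => T q p a * g p a := by
    intro q a
    have hCg : 0 ≤ Cg := nonneg_of_mul_nonneg_left ((abs_nonneg _).trans (hg 0 a)) (Real.exp_pos _)
    have hCT : 0 ≤ CT := nonneg_of_mul_nonneg_left ((abs_nonneg _).trans (hT 0 0 a)) (Real.exp_pos _)
    refine Summable.of_norm_bounded ((summable_exp_shift' hδg z).mul_left (CT * Cg)) (fun p => ?_)
    rw [Real.norm_eq_abs, abs_mul]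
    calc |T q p a| * |g p a| ≤ (CT * Real.exp (-δT * l1 (p - q))) * (Cg * Real.exp (-δg * l1 (p - z))) := mul_le_mul (hT q p a) (hg p a) (abs_nonneg _) (by positivity)
      _ ≤ (CT * 1) * (Cg * Real.exp (-δg * l1 (p - z))) := by
          refine mul_le_mul_of_nonneg_right (mul_le_mul_of_nonneg_left ?_ hCT) (by positivity)
          rw [Real.exp_le_one_iff]; nlinarith [l1_nonneg (p - q)]
      _ = CT * Cg * Real.exp (-δg * l1 (p - z)) := by ring
  have eQ : ∀ q : Site (d + 1), H q * ∑' p : Site (d + 1), ∑ a : Fib d, T q p a * g p a = ∑ a : Fib d, H q * ∑' p : Site (d + 1), T q p a * g p a := by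
    intro q
    rw [Summable.tsum_finsetSum (fun a _ => hsumPa q a), Finset.mul_sum]
  have eP : ∀ p : Site (d + 1), ∑ a : Fib d, (∑' q : Site (d + 1), H q * T q p a) * g p a = ∑ a : Fib d, (∑' q : Site (d + 1), H q * T q p a) * g p a := fun p => rfl
  refine ⟨(summable_sum fun a _ => hsumQ a).congr fun q => (eQ q).symm, summable_sum fun a _ => hsumP a, ?_⟩
  rw [tsum_congr eQ, Summable.tsum_finsetSum (fun a _ => hsumQ a), Summable.tsum_finsetSum (fun a _ => hsumP a)]
  refine Finset.sum_congr rfl fun a _ => ?_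
  rw [tsum_congr (hinnerQ a) |>.symm, hswap a]
  exact tsum_congr fun p => hinnerP a p

/-! ## §4 The expansion -/

/-- [folklore] **THE SLOT∕LEG-WEIGHTED CURRENT OF THE CUBIC SECTOR, FREE LEG SECOND, THROUGH ONE PASSIVE `G_j`**: for `|σ|, |ρ| ≤ 1` and a leg datum `ρ ê_β` whose multiplier response under
`G_j` vanishes,
`Σ'_w ρ w·Σ'_t σ t·e3OfK Lc G_j S ν t w y (inl β)(inl μ) = Σ'_p Σ_a (Σ_κ″ Σ'_q H_ρ(κ″,q)·Σ_κ‴ Σ'_u H_σ(κ‴,u)·S κ‴ u q p (inl κ″) a)·G_j p (Lc•y) a (inr μ)`,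
`H_ρ(κ″,q) = Σ'_w ρ w·colH G_j Lc β w κ″ q`, `H_σ(κ‴,u) = Σ'_t σ t·colH G_j Lc ν t κ‴ u`; the `p`-family on the right is summable. -/
theorem faceSlot_current_eq_tsum_freeLeg (hr : r ∈ box (d + 1) Lc) (j : ℕ) (hS : LocStencil S Cs δs) (hδs : 0 < δs)
    {σ ρ : Site (d + 1) → ℝ} (hσ : ∀ t, |σ t| ≤ 1) (hρ : ∀ w, |ρ w| ≤ 1) (ν β : Fin (d + 1))
    (hM : ∀ (m : Fin (d + 1)) (q : Site (d + 1)), ∑' w : Site (d + 1), ρ w * coDressKBmAt (toSite r) Lc (KInvStep (d := d) Lc j) q ((Lc : ℤ) • w) (Sum.inr m) (Sum.inr β) = 0)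
    (y : Site (d + 1)) (μ : Fin (d + 1)) :
    (Summable fun p : Site (d + 1) => ∑ a : Fib d,
      (∑ κ₂ : Fin (d + 1), ∑' q : Site (d + 1), (∑' w : Site (d + 1), ρ w * colH (coDressKBmAt (toSite r) Lc (KInvStep (d := d) Lc j)) Lc β w κ₂ q) *
        ∑ κ₃ : Fin (d + 1), ∑' u : Site (d + 1), (∑' t : Site (d + 1), σ t * colH (coDressKBmAt (toSite r) Lc (KInvStep (d := d) Lc j)) Lc ν t κ₃ u) *
          S κ₃ u q p (Sum.inl κ₂) a) * coDressKBmAt (toSite r) Lc (KInvStep (d := d) Lc j) p ((Lc : ℤ) • y) a (Sum.inr μ)) ∧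
    ∑' w : Site (d + 1), ρ w * ∑' t : Site (d + 1), σ t * e3OfK Lc (coDressKBmAt (toSite r) Lc (KInvStep (d := d) Lc j)) S ν t w y (Sum.inl β) (Sum.inl μ) =
      ∑' p : Site (d + 1), ∑ a : Fib d,
        (∑ κ₂ : Fin (d + 1), ∑' q : Site (d + 1), (∑' w : Site (d + 1), ρ w * colH (coDressKBmAt (toSite r) Lc (KInvStep (d := d) Lc j)) Lc β w κ₂ q) *
          ∑ κ₃ : Fin (d + 1), ∑' u : Site (d + 1), (∑' t : Site (d + 1), σ t * colH (coDressKBmAt (toSite r) Lc (KInvStep (d := d) Lc j)) Lc ν t κ₃ u) *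
            S κ₃ u q p (Sum.inl κ₂) a) * coDressKBmAt (toSite r) Lc (KInvStep (d := d) Lc j) p ((Lc : ℤ) • y) a (Sum.inr μ) := by
  classical
  have hLc : 1 ≤ Lc := Nat.one_le_iff_ne_zero.mpr (NeZero.ne Lc)
  -- constants: decay of `G_j`, bi-localisation of the vertex family, of `𝒱 ∘ G` and of `G ∘ (𝒱 ∘ G)`
  obtain ⟨δK, CK, hδK, hCK, hG⟩ := decays_coDressKBmAt_KInvStep (d := d) hr j
  have hCs : 0 ≤ Cs := (hS 0 0).nonneg (Sum.inl 0)
  obtain ⟨m, hm0, hmK, hmS⟩ : ∃ m : ℝ, 0 < m ∧ m ≤ δK ∧ m ≤ δs := ⟨min δK δs, lt_min hδK hδs, min_le_left _ _, min_le_right _ _⟩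
  have hG1 : Decays (coDressKBmAt (toSite r) Lc (KInvStep (d := d) Lc j)) CK m := decays_mono hG hCK le_rfl hmK
  have hG2 : Decays (coDressKBmAt (toSite r) Lc (KInvStep (d := d) Lc j)) CK (m / 2) := decays_mono hG hCK le_rfl (by linarith)
  have hG3 : Decays (coDressKBmAt (toSite r) Lc (KInvStep (d := d) Lc j)) CK (m / 4) := decays_mono hG hCK le_rfl (by linarith)
  have hS1 : LocStencil S Cs m := fun κ u => biLoc_mono (hS κ u) hCs hmS
  have hV := vertexFamily_vertexOfK (N := Lc) hG1 hCK hS1 hm0 le_rfl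
  have hKt := trK_coDressKBmAt_KInvStep (d := d) hr j
  have hW : ∀ t : Site (d + 1), BiLoc (comp (vertexOfK (coDressKBmAt (toSite r) Lc (KInvStep (d := d) Lc j)) Lc S ν t) (coDressKBmAt (toSite r) Lc (KInvStep (d := d) Lc j)))
      ((Lc : ℤ) • t) ((Lc : ℤ) • t) _ (m / 4) := fun t => biLoc_comp_right (hV ν t) hG2 (by positivity) (by linarith)
  have hY : ∀ t : Site (d + 1), BiLoc (comp (coDressKBmAt (toSite r) Lc (KInvStep (d := d) Lc j))
      (comp (vertexOfK (coDressKBmAt (toSite r) Lc (KInvStep (d := d) Lc j)) Lc S ν t) (coDressKBmAt (toSite r) Lc (KInvStep (d := d) Lc j))))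
      ((Lc : ℤ) • t) ((Lc : ℤ) • t) _ (m / 8) := fun t => biLoc_comp_decays hG3 (hW t) (by positivity) (by linarith)
  -- the two responses are bounded
  have hH : ∀ (κ₂ : Fin (d + 1)) (q : Site (d + 1)), |∑' w : Site (d + 1), ρ w * colH (coDressKBmAt (toSite r) Lc (KInvStep (d := d) Lc j)) Lc β w κ₂ q| ≤
      1 * CK * (Real.exp (m / 4 * ((Lc : ℝ) * (d + 1))) * Zl (d + 1) (m / 4)) := fun κ₂ q => abs_legResponse_le hG3 (by positivity) hρ β κ₂ q
  have hHσ : ∀ (κ₃ : Fin (d + 1)) (u : Site (d + 1)), |∑' t : Site (d + 1), σ t * colH (coDressKBmAt (toSite r) Lc (KInvStep (d := d) Lc j)) Lc ν t κ₃ u| ≤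
      1 * CK * (Real.exp (m / 4 * ((Lc : ℝ) * (d + 1))) * Zl (d + 1) (m / 4)) := fun κ₃ u => abs_legResponse_le hG3 (by positivity) hσ ν κ₃ u
  -- the level-`j` two-leg current decays in `|p − q|`, the passive factor decays from `Lc•y`
  have hT : ∀ (κ₂ : Fin (d + 1)) (q p : Site (d + 1)) (a : Fib d),
      |∑ κ₃ : Fin (d + 1), ∑' u : Site (d + 1), (∑' t : Site (d + 1), σ t * colH (coDressKBmAt (toSite r) Lc (KInvStep (d := d) Lc j)) Lc ν t κ₃ u) * S κ₃ u q p (Sum.inl κ₂) a| ≤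
        ((d + 1 : ℕ) * ((1 * CK * (Real.exp (m / 4 * ((Lc : ℝ) * (d + 1))) * Zl (d + 1) (m / 4))) * Cs * Zl (d + 1) (δs / 2))) * Real.exp (-(δs / 2) * l1 (p - q)) := by
    intro κ₂ q p a
    calc _ ≤ ∑ κ₃ : Fin (d + 1), |∑' u : Site (d + 1), (∑' t : Site (d + 1), σ t * colH (coDressKBmAt (toSite r) Lc (KInvStep (d := d) Lc j)) Lc ν t κ₃ u) * S κ₃ u q p (Sum.inl κ₂) a| :=
          Finset.abs_sum_le_sum_abs _ _
      _ ≤ ∑ _κ₃ : Fin (d + 1), ((1 * CK * (Real.exp (m / 4 * ((Lc : ℝ) * (d + 1))) * Zl (d + 1) (m / 4))) * Cs * Zl (d + 1) (δs / 2)) * Real.exp (-(δs / 2) * l1 (p - q)) :=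
          Finset.sum_le_sum fun κ₃ _ => abs_tsum_slot_locStencil_le hS hδs (hHσ κ₃) κ₃ q p (Sum.inl κ₂) a
      _ = _ := by rw [Finset.sum_const, Finset.card_univ, Fintype.card_fin, nsmul_eq_mul]; ring
  have hg : ∀ (p : Site (d + 1)) (a : Fib d), |coDressKBmAt (toSite r) Lc (KInvStep (d := d) Lc j) p ((Lc : ℤ) • y) a (Sum.inr μ)| ≤ CK * Real.exp (-δK * l1 (p - (Lc : ℤ) • y)) :=
    fun p a => hG p _ a _
  -- (1) pointwise; (2) the `(w,t)` exchange; (3) the `w`-contraction of the LEFT resolvent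
  have e1 : ∀ w t : Site (d + 1), e3OfK Lc (coDressKBmAt (toSite r) Lc (KInvStep (d := d) Lc j)) S ν t w y (Sum.inl β) (Sum.inl μ) =
      -(comp (coDressKBmAt (toSite r) Lc (KInvStep (d := d) Lc j)) (comp (vertexOfK (coDressKBmAt (toSite r) Lc (KInvStep (d := d) Lc j)) Lc S ν t)
        (coDressKBmAt (toSite r) Lc (KInvStep (d := d) Lc j))) ((Lc : ℤ) • w) ((Lc : ℤ) • y) (Sum.inr β) (Sum.inr μ)) :=
    fun w t => e3OfK_inl_inl_eq_neg_comp hG2 (by positivity) ν (hV ν t) w y β μ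
  have e2 := tsum_leg_slot_comm hY (by positivity) hσ hρ ((Lc : ℤ) • y) (Sum.inr β) (Sum.inr μ)
  have e3 : ∀ t : Site (d + 1), ∑' w : Site (d + 1), ρ w * comp (coDressKBmAt (toSite r) Lc (KInvStep (d := d) Lc j))
      (comp (vertexOfK (coDressKBmAt (toSite r) Lc (KInvStep (d := d) Lc j)) Lc S ν t) (coDressKBmAt (toSite r) Lc (KInvStep (d := d) Lc j)))
        ((Lc : ℤ) • w) ((Lc : ℤ) • y) (Sum.inr β) (Sum.inr μ) =
      -(∑ κ₂ : Fin (d + 1), ∑' q : Site (d + 1), (∑' w : Site (d + 1), ρ w * colH (coDressKBmAt (toSite r) Lc (KInvStep (d := d) Lc j)) Lc β w κ₂ q) *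
        comp (vertexOfK (coDressKBmAt (toSite r) Lc (KInvStep (d := d) Lc j)) Lc S ν t) (coDressKBmAt (toSite r) Lc (KInvStep (d := d) Lc j)) q ((Lc : ℤ) • y) (Sum.inl κ₂) (Sum.inr μ)) :=
    fun t => tsum_leg_comp_eq_neg_fieldResponse hLc hG3 (by positivity) hKt (hW t) (by positivity) hρ β hM ((Lc : ℤ) • y) (Sum.inr μ)
  -- (4) the `(q,t)` exchange; (5) the `(t,p)` exchange and the vertex opened; (6) the `(q,p)` exchange
  have hF := fun κ₂ : Fin (d + 1) => tsum_midleg_slot_comm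
    (V := fun t => comp (vertexOfK (coDressKBmAt (toSite r) Lc (KInvStep (d := d) Lc j)) Lc S ν t) (coDressKBmAt (toSite r) Lc (KInvStep (d := d) Lc j)))
    hW (by positivity) hσ (hH κ₂) ((Lc : ℤ) • y) (Sum.inl κ₂) (Sum.inr μ)
  have e5 := fun (κ₂ : Fin (d + 1)) (q : Site (d + 1)) => (tsum_slot_comp_right (V := fun t => vertexOfK (coDressKBmAt (toSite r) Lc (KInvStep (d := d) Lc j)) Lc S ν t)
    (fun t => hV ν t) (by positivity) hG hδK.le hσ q ((Lc : ℤ) • y) (Sum.inl κ₂) (Sum.inr μ)).2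
  have e5' := fun (q p : Site (d + 1)) (κ₂ : Fin (d + 1)) (a : Fib d) => tsum_slotWeight_vertexOfK hLc hG1 hm0 hS1 hm0 hσ ν q p (Sum.inl κ₂) a
  have e6 := fun κ₂ : Fin (d + 1) => tsum_midleg_freeleg_comm (hH κ₂) (half_pos hδs) (hT κ₂) hδK hg
  refine ⟨?_, ?_⟩
  · -- summability of the final `p`-family: finite sum over `κ₂` of the summable families of (6), regrouped
    have h := summable_sum (s := (Finset.univ : Finset (Fin (d + 1)))) fun κ₂ _ => (e6 κ₂).2.1
    refine h.congr fun p => ?_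
    rw [Finset.sum_comm]
    refine Finset.sum_congr rfl fun a _ => ?_
    rw [Finset.sum_mul]
  · calc ∑' w : Site (d + 1), ρ w * ∑' t : Site (d + 1), σ t * e3OfK Lc (coDressKBmAt (toSite r) Lc (KInvStep (d := d) Lc j)) S ν t w y (Sum.inl β) (Sum.inl μ)
        = -(∑' t : Site (d + 1), σ t * ∑' w : Site (d + 1), ρ w * comp (coDressKBmAt (toSite r) Lc (KInvStep (d := d) Lc j))
            (comp (vertexOfK (coDressKBmAt (toSite r) Lc (KInvStep (d := d) Lc j)) Lc S ν t) (coDressKBmAt (toSite r) Lc (KInvStep (d := d) Lc j)))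
            ((Lc : ℤ) • w) ((Lc : ℤ) • y) (Sum.inr β) (Sum.inr μ)) := by
          rw [← e2, ← tsum_neg]
          refine tsum_congr fun w => ?_
          rw [← mul_neg, ← tsum_neg]
          congr 1
          exact tsum_congr fun t => by rw [e1 w t, mul_neg]
      _ = ∑' t : Site (d + 1), σ t * ∑ κ₂ : Fin (d + 1), ∑' q : Site (d + 1),
            (∑' w : Site (d + 1), ρ w * colH (coDressKBmAt (toSite r) Lc (KInvStep (d := d) Lc j)) Lc β w κ₂ q) *
              comp (vertexOfK (coDressKBmAt (toSite r) Lc (KInvStep (d := d) Lc j)) Lc S ν t) (coDressKBmAt (toSite r) Lc (KInvStep (d := d) Lc j)) q ((Lc : ℤ) • y) (Sum.inl κ₂) (Sum.inr μ) := by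
          rw [← tsum_neg]
          exact tsum_congr fun t => by rw [e3 t, mul_neg, neg_neg]
      _ = ∑ κ₂ : Fin (d + 1), ∑' t : Site (d + 1), σ t * ∑' q : Site (d + 1),
            (∑' w : Site (d + 1), ρ w * colH (coDressKBmAt (toSite r) Lc (KInvStep (d := d) Lc j)) Lc β w κ₂ q) *
              comp (vertexOfK (coDressKBmAt (toSite r) Lc (KInvStep (d := d) Lc j)) Lc S ν t) (coDressKBmAt (toSite r) Lc (KInvStep (d := d) Lc j)) q ((Lc : ℤ) • y) (Sum.inl κ₂) (Sum.inr μ) := by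
          rw [← Summable.tsum_finsetSum (fun κ₂ _ => (hF κ₂).1)]
          exact tsum_congr fun t => Finset.mul_sum _ _ _
      _ = ∑ κ₂ : Fin (d + 1), ∑' q : Site (d + 1), (∑' w : Site (d + 1), ρ w * colH (coDressKBmAt (toSite r) Lc (KInvStep (d := d) Lc j)) Lc β w κ₂ q) *
            ∑' p : Site (d + 1), ∑ a : Fib d,
              (∑ κ₃ : Fin (d + 1), ∑' u : Site (d + 1), (∑' t : Site (d + 1), σ t * colH (coDressKBmAt (toSite r) Lc (KInvStep (d := d) Lc j)) Lc ν t κ₃ u) * S κ₃ u q p (Sum.inl κ₂) a) *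
                coDressKBmAt (toSite r) Lc (KInvStep (d := d) Lc j) p ((Lc : ℤ) • y) a (Sum.inr μ) := by
          refine Finset.sum_congr rfl fun κ₂ _ => ?_
          rw [(hF κ₂).2]
          refine tsum_congr fun q => ?_
          rw [e5 κ₂ q]
          congr 1
          refine tsum_congr fun p => Finset.sum_congr rfl fun a _ => ?_
          rw [e5' q p κ₂ a]
      _ = ∑ κ₂ : Fin (d + 1), ∑' p : Site (d + 1), ∑ a : Fib d,
            (∑' q : Site (d + 1), (∑' w : Site (d + 1), ρ w * colH (coDressKBmAt (toSite r) Lc (KInvStep (d := d) Lc j)) Lc β w κ₂ q) *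
              ∑ κ₃ : Fin (d + 1), ∑' u : Site (d + 1), (∑' t : Site (d + 1), σ t * colH (coDressKBmAt (toSite r) Lc (KInvStep (d := d) Lc j)) Lc ν t κ₃ u) * S κ₃ u q p (Sum.inl κ₂) a) *
                coDressKBmAt (toSite r) Lc (KInvStep (d := d) Lc j) p ((Lc : ℤ) • y) a (Sum.inr μ) :=
          Finset.sum_congr rfl fun κ₂ _ => (e6 κ₂).2.2
      _ = _ := by
          rw [← Summable.tsum_finsetSum (fun κ₂ _ => (e6 κ₂).2.1)]
          refine tsum_congr fun p => ?_
          rw [Finset.sum_comm]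
          refine Finset.sum_congr rfl fun a _ => ?_
          rw [Finset.sum_mul]

end Summit.QuantumFields.BalabanUV.Beta.GAN24.CubicSectorCurrentExpansion

end
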